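import Summits.ResolutionOfSingularities.ResolutionOfSingularities.Theorems.WildConesCampaignW46HypersurfacesCharTwoDegFormCalculus
import Summits.ResolutionOfSingularities.ResolutionOfSingularities.Theorems.WildConesCampaignW46HypersurfacesCharTwoEmbDimMonotone

/-!
# [OURS · L1 W4.6, rung (ii) at p = 2, EVERY dimension n] THE SUCCESSOR'S POLAR MATRIX AND ITS CORANK:
# at a near double point `w` of a corank-two double point, the successor has corank TWO iff `w` is a
# SINGULAR POINT of the tangent cubic on the kernel plane (all polars at `w` vanish there), and corank
# ZERO (resolved by the next blow-up) iff `w` is a simple point — `z² = a(u₁,…,uₙ)`, every field of char 2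

HONEST FRAMING. Everything here is OURS: theorems about route WildCones' own TYPED point-blow-up dynamics
(`Theorems/WildConesClassicalRegimesDefs.lean`: `step i τ c`, `MultP`, `Isol`, `mu`) and the seat's
invariants `polarMatrix` (p502936), `milnorEmbDim` (p498937: `e = dim ker P`), `degForm` (p522667). NOTHING
here is a statement of the manuscript [Hironaka2017]; no FACT-LIST premise; AI review is weaker than expert
review. Cell res-hironaka (LADDER-RESOLUTION rung L, D-0089), slot W4.6, seat res-L1-s46-pv-4 (gen 5); host
route `WildCones`, crux `ClassicalRegimes` (stmt-ResolutionOfSingularities-16884; proved).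

WHY. Gen 4 left the class `(e, h₂) = (2, 2)` «not closed» without a kernel statement deciding WHICH near
points continue the corank-two chain. This file decides it from the 3-jet, at every near point:

* `coeff_pair_self_strict`, `polarMatrix_ser_step_*` — **THE SUCCESSOR'S POLAR MATRIX**: for a strict
  transform pair `X_i² G = a∘Φ_{i,τ}`, `[X_i X_l] G = (∂_l a)₂(w)` (`l ≠ i`, `w = (τ with w_i = 1)`), while
  `[X_j X_l] G = [X_j X_l] a` off the chart index (the tree's `coeff_pair_strict`): the new polar matrix is
  the old one with row and column `i` replaced by the GRADIENT OF THE TANGENT CUBIC at `w`,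
  `g_l = degForm 2 (∂_l a) w`.
* `hypersurface_milnorEmbDim_step_eq_two_iff` — **THE SUCCESSOR'S CORANK** (double state `c`, `e(c) = 2`,
  double successor at `(i, τ)`, near vector `w`): `e(successor) = 2` IFF `Σ_l v_l g_l = 0` for every
  kernel vector `v` of `P` (`w` is a SINGULAR point of the binary cubic `a₃|_{ker P}`, a multiple tangent
  direction); otherwise `e(successor) = 0` (`hypersurface_milnorEmbDim_step_eq_zero_iff`). Proof: if the
  polars vanish, a kernel vector `u` with `u_i = 0` is in `ker P'`, and `e' ∈ {0, 2}` (p515087) forces `2`;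
  if `z ∈ ker P'`, `z ≠ 0`, then either `z_i = 0`, `z ∈ ker P` and the polars at `w` vanish on
  `ker P = ⟨w, z⟩`, or `z_i ≠ 0` and `g` is in the row space of `P`, so `g ⊥ ker P`.
* `hypersurface_simple_tangent_resolved` — at a simple point of the kernel cubic the successor is ISOLATED
  with `μ = 1` and has no double point after it (the FREE near points terminate at once);
  `hypersurface_singular_direction_corank_two` — a singular direction `λ` of the kernel cubic IS a near
  double point (Euler: `a₃(λ) = Σ λ_l (∂_l a)₂(λ)`) and its successor has corank two again (the SATELLITE
  point continuing the corank-two chain; with `h₂ ≤ 2` it is isolated with smaller `μ` by gen 4).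

References: [CasasAlvero2000] §3 (free/satellite points: context); [GreuelPfister2026] (context);
[Hironaka2017] Th. 16.6 p.84 — role replaced only, under adjudication.
-/

noncomputable section

-- single-problem summit: the doubled namespace component `ResolutionOfSingularities` is forced
set_option linter.dupNamespace false

open scoped BigOperators Classical
open MvPowerSeries IsLocalRing
open Literature.AlgebraicGeometry.Resolution

namespace Summit.ResolutionOfSingularities.ResolutionOfSingularities.Theorems

namespace CampaignW46.HypersurfacesCharTwo

open WildCones WildCones.MuDropCharTwoOrdP ThreefoldsCharTwo

variable {κ : Type} [Field κ] {n : ℕ}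

/-! ## The successor's polar matrix -/

/-- [OURS · L1 W4.6] **`[X_i X_l] G = (∂_l a)₂(w)`**: for a strict-transform pair `X_i² G = a∘Φ_{i,τ}`
(any field) and `l ≠ i`, the `X_iX_l`-coefficient of `G` is the quadratic form of `∂_l a` at the near
vector (`∂_l (a∘Φ) = X_i (∂_l a)∘Φ` and the pure-power formula p523523). [folklore] -/
theorem coeff_pair_self_strict (i : Fin n) (τ : Fin n → κ) {a G : MvPowerSeries (Fin n) κ}
    (hG : X i ^ 2 * G = subst (fun s => if s = i then (X i : MvPowerSeries (Fin n) κ)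
      else X i * (X s + C (τ s))) a) {l : Fin n} (hl : l ≠ i) :
    coeff (Finsupp.single i 1 + Finsupp.single l 1) G =
      degForm 2 (MvPowerSeries.pderiv l a) (Function.update τ i 1) := by
  -- `[X_i³ X_l]` of both sides, read through `∂_l`
  have hexp : (Finsupp.single i 3 + Finsupp.single l 1 : Fin n →₀ ℕ) =
      Finsupp.single i 1 + (Finsupp.single i 1 + (Finsupp.single i 1 + Finsupp.single l 1)) := by
    rw [← add_assoc, ← add_assoc, ← Finsupp.single_add, ← Finsupp.single_add]
  have h1 : coeff (Finsupp.single i 3 + Finsupp.single l 1) (X i ^ 2 * G) =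
      coeff (Finsupp.single i 1 + Finsupp.single l 1) G := by
    rw [hexp, pow_two, mul_assoc, coeff_single_add_X_mul, coeff_single_add_X_mul]
  have h2 : ∀ g : MvPowerSeries (Fin n) κ, coeff (Finsupp.single i 3 + Finsupp.single l 1) g =
      coeff (Finsupp.single i 3) (MvPowerSeries.pderiv l g) := by
    intro g
    rw [MvPowerSeries.coeff_pderiv, Finsupp.single_apply, if_neg (Ne.symm hl), Nat.cast_zero, zero_add, one_mul]
  have h3 := congrArg (coeff (Finsupp.single i 3 + Finsupp.single l 1)) hG
  rw [h1, h2, pderiv_subst_blowFam_of_ne i τ hl,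
    show (Finsupp.single i 3 : Fin n →₀ ℕ) = Finsupp.single i 1 + Finsupp.single i 2 by
      rw [← Finsupp.single_add],
    coeff_single_add_X_mul, coeff_single_pow_subst_blowFam_eq_degForm] at h3
  exact h3

/-- [OURS · L1 W4.6] The route's successor: `[u_i u_l] (ser (step i τ c)) = (∂_l a)₂(w)` for `l ≠ i`
(the monomial `u_i u_l` is not a square, so the final cleaning keeps it). [folklore] -/
theorem coeff_pair_self_ser_step [CharP κ 2] (c : (Fin n → ℕ) → κ) (i : Fin n) (τ : Fin n → κ)
    (hM : MultP 2 n κ c) {l : Fin n} (hl : l ≠ i) :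
    coeff (Finsupp.single i 1 + Finsupp.single l 1) (ser 2 n κ (step 2 n κ i τ c)) =
      degForm 2 (MvPowerSeries.pderiv l (ser 2 n κ c)) (Function.update τ i 1) := by
  rw [coeff_ser_step c i τ hM]
  have hi1 : ¬ 2 ∣ (⇑(Finsupp.single i 1 + Finsupp.single l 1 : Fin n →₀ ℕ)) i := by
    simp [Ne.symm hl]
  rw [OrdPExitSurface.clean_apply_of_not_dvd _ _ i hi1]
  exact coeff_pair_self_strict i τ (X_pow_mul_serT_eq_subst c i τ hM) hl

/-- [OURS · L1 W4.6] **The successor's polar matrix OFF the chart index is the old one.** [folklore] -/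
theorem polarMatrix_ser_step_of_ne [CharP κ 2] (c : (Fin n → ℕ) → κ) (i : Fin n) (τ : Fin n → κ)
    (hM : MultP 2 n κ c) {j l : Fin n} (hj : j ≠ i) (hl : l ≠ i) :
    polarMatrix (ser 2 n κ (step 2 n κ i τ c)) j l = polarMatrix (ser 2 n κ c) j l := by
  by_cases hjl : j = l
  · subst hjl; rw [polarMatrix_diag, polarMatrix_diag]
  · simp only [polarMatrix, Matrix.of_apply, if_neg hjl]
    exact coeff_pair_ser_step c i τ hM hjl hj hl

/-- [OURS · L1 W4.6] **The successor's polar matrix IN ROW `i` is the gradient of the tangent cubic at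
the near vector**: `P'_{i l} = (∂_l a)₂(w)` (`l ≠ i`). [folklore] -/
theorem polarMatrix_ser_step_row [CharP κ 2] (c : (Fin n → ℕ) → κ) (i : Fin n) (τ : Fin n → κ)
    (hM : MultP 2 n κ c) {l : Fin n} (hl : l ≠ i) :
    polarMatrix (ser 2 n κ (step 2 n κ i τ c)) i l =
      degForm 2 (MvPowerSeries.pderiv l (ser 2 n κ c)) (Function.update τ i 1) := by
  simp only [polarMatrix, Matrix.of_apply, if_neg (Ne.symm hl)]
  exact coeff_pair_self_ser_step c i τ hM hl

/-- [OURS · L1 W4.6] In column `i`: `P'_{j i} = (∂_j a)₂(w)` (`j ≠ i`). [folklore] -/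
theorem polarMatrix_ser_step_col [CharP κ 2] (c : (Fin n → ℕ) → κ) (i : Fin n) (τ : Fin n → κ)
    (hM : MultP 2 n κ c) {j : Fin n} (hj : j ≠ i) :
    polarMatrix (ser 2 n κ (step 2 n κ i τ c)) j i =
      degForm 2 (MvPowerSeries.pderiv j (ser 2 n κ c)) (Function.update τ i 1) := by
  rw [polarMatrix_symm, polarMatrix_ser_step_row c i τ hM hj]

/-- [OURS · L1 W4.6] **Vectors through the successor's polar matrix, off the chart index**:
`(v·P')_l = (v⁰·P)_l + v_i g_l` with `v⁰ = (v with v_i = 0)`, `g_l = (∂_l a)₂(w)`. [folklore] -/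
theorem vecMul_polarMatrix_ser_step_of_ne [CharP κ 2] (c : (Fin n → ℕ) → κ) (i : Fin n)
    (τ : Fin n → κ) (hM : MultP 2 n κ c) (v : Fin n → κ) {l : Fin n} (hl : l ≠ i) :
    Matrix.vecMul v (polarMatrix (ser 2 n κ (step 2 n κ i τ c))) l =
      Matrix.vecMul (Function.update v i 0) (polarMatrix (ser 2 n κ c)) l +
        v i * degForm 2 (MvPowerSeries.pderiv l (ser 2 n κ c)) (Function.update τ i 1) := by
  simp only [Matrix.vecMul, dotProduct]
  rw [← Finset.add_sum_erase _ _ (Finset.mem_univ i), ← Finset.add_sum_erase _ _ (Finset.mem_univ i),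
    Function.update_self, zero_mul, zero_add, polarMatrix_ser_step_row c i τ hM hl, add_comm]
  congr 1
  refine Finset.sum_congr rfl fun j hj => ?_
  have hji : j ≠ i := Finset.ne_of_mem_erase hj
  rw [Function.update_of_ne hji, polarMatrix_ser_step_of_ne c i τ hM hji hl]

/-- [OURS · L1 W4.6] **… at the chart index**: `(v·P')_i = Σ_j v⁰_j g_j`. [folklore] -/
theorem vecMul_polarMatrix_ser_step_self [CharP κ 2] (c : (Fin n → ℕ) → κ) (i : Fin n)
    (τ : Fin n → κ) (hM : MultP 2 n κ c) (v : Fin n → κ) :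
    Matrix.vecMul v (polarMatrix (ser 2 n κ (step 2 n κ i τ c))) i =
      ∑ j, Function.update v i 0 j * degForm 2 (MvPowerSeries.pderiv j (ser 2 n κ c)) (Function.update τ i 1) := by
  simp only [Matrix.vecMul, dotProduct]
  rw [← Finset.add_sum_erase _ _ (Finset.mem_univ i), ← Finset.add_sum_erase _ _ (Finset.mem_univ i),
    Function.update_self, zero_mul, zero_add, polarMatrix_diag, mul_zero, zero_add]
  refine Finset.sum_congr rfl fun j hj => ?_
  have hji : j ≠ i := Finset.ne_of_mem_erase hj
  rw [Function.update_of_ne hji, polarMatrix_ser_step_col c i τ hM hji]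

/-! ## Linear algebra on the kernel plane -/

/-- [OURS · L1 W4.6] In corank two, two kernel vectors `w ≠ 0` and `z ∉ κ w` SPAN the kernel. [folklore] -/
theorem kernel_span_pair [CharP κ 2] {c : (Fin n → ℕ) → κ} (hM : MultP 2 n κ c)
    (he : milnorEmbDim 2 n κ c = 2) {w z : Fin n → κ} (hw0 : w ≠ 0)
    (hw : Matrix.vecMul w (polarMatrix (ser 2 n κ c)) = 0) (hz : Matrix.vecMul z (polarMatrix (ser 2 n κ c)) = 0)
    (hnot : ∀ r : κ, z ≠ r • w) :
    ∀ v : Fin n → κ, Matrix.vecMul v (polarMatrix (ser 2 n κ c)) = 0 → ∃ a b : κ, a • w + b • z = v := by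
  set K := LinearMap.ker (polarMatrix (ser 2 n κ c)).mulVecLin with hK
  have hfr : Module.finrank κ K = 2 := by rw [hK, finrank_ker_polarMatrix hM, he]
  have hwK : w ∈ K := (mem_ker_polarMatrix_iff _ _).mpr hw
  have hzK : z ∈ K := (mem_ker_polarMatrix_iff _ _).mpr hz
  set M := Submodule.span κ ({w, z} : Set (Fin n → κ)) with hMdef
  have hMK : M ≤ K := by
    rw [hMdef, Submodule.span_le]
    intro x hx
    rcases hx with rfl | hx
    · exact hwK
    · rw [Set.mem_singleton_iff] at hx; rw [hx]; exact hzK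
  have hzL : z ∉ (κ ∙ w) := fun h => by
    obtain ⟨r, hr⟩ := Submodule.mem_span_singleton.mp h
    exact hnot r hr.symm
  have hLM : (κ ∙ w) < M := by
    refine lt_of_le_of_ne (Submodule.span_mono (Set.singleton_subset_iff.mpr (Set.mem_insert w _))) (fun hEq => ?_)
    apply hzL
    rw [hEq, hMdef]
    exact Submodule.subset_span (Set.mem_insert_of_mem _ (Set.mem_singleton z))
  haveI : FiniteDimensional κ K := FiniteDimensional.finiteDimensional_submodule K
  haveI : FiniteDimensional κ M := Submodule.finiteDimensional_of_le hMK
  have hfrM : 2 ≤ Module.finrank κ M := by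
    have h1 := Submodule.finrank_lt_finrank_of_lt hLM
    rw [finrank_span_singleton hw0] at h1
    omega
  have hMeq : M = K := Submodule.eq_of_le_of_finrank_le hMK (by rw [hfr]; exact hfrM)
  intro v hv
  have hvM : v ∈ M := by rw [hMeq]; exact (mem_ker_polarMatrix_iff _ _).mpr hv
  rw [hMdef, Submodule.mem_span_pair] at hvM
  exact hvM

/-- [OURS · L1 W4.6] `(x·P)·y = x·(y·P)` for the symmetric polar matrix. [folklore] -/
theorem vecMul_polarMatrix_dotProduct (f : MvPowerSeries (Fin n) κ) (x y : Fin n → κ) :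
    Matrix.vecMul x (polarMatrix f) ⬝ᵥ y = x ⬝ᵥ Matrix.vecMul y (polarMatrix f) := by
  rw [← Matrix.dotProduct_mulVec, mulVec_polarMatrix_eq_vecMul]
/-! ## The successor's corank -/

/-- [OURS · L1 W4.6 rung (ii) at `p = 2`, EVERY dimension `n`; NOT a statement of the manuscript] **THE
SUCCESSOR'S CORANK AT A NEAR POINT OF A CORANK-TWO DOUBLE POINT.** Let `c` be a double state of
`z² = a(u₁,…,uₙ)` (any field of characteristic `2`) with `e(c) = 2`, and let `(i, τ)` give a double
successor, near vector `w = (τ with w_i = 1)`, gradient of the tangent cubic `g_l = degForm 2 (∂_l a) w`.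
Then `e(successor) = 2` IF AND ONLY IF `Σ_l v_l g_l = 0` for every kernel vector `v` of the polar form —
ALL POLARS OF `a₃` AT `w` VANISH ON THE KERNEL PLANE: `w` is a singular point of the binary cubic
`a₃|_{ker P}`, a MULTIPLE tangent direction. (Otherwise `e(successor) = 0`: next theorem.) It decides, from
the 3-jet, which infinitely-near double points continue the corank-two chain — the role of the satellite
/free distinction of plane-curve desingularisation, for OUR dynamics; NOT a statement of the manuscript.
[folklore] -/
theorem hypersurface_milnorEmbDim_step_eq_two_iff [CharP κ 2] (c : (Fin n → ℕ) → κ) (i : Fin n)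
    (τ : Fin n → κ) (hM : MultP 2 n κ c) (he : milnorEmbDim 2 n κ c = 2)
    (hM' : MultP 2 n κ (step 2 n κ i τ c)) :
    milnorEmbDim 2 n κ (step 2 n κ i τ c) = 2 ↔
      ∀ v : Fin n → κ, Matrix.vecMul v (polarMatrix (ser 2 n κ c)) = 0 →
        ∑ l, v l * degForm 2 (MvPowerSeries.pderiv l (ser 2 n κ c)) (Function.update τ i 1) = 0 := by
  set P := polarMatrix (ser 2 n κ c) with hP
  set P' := polarMatrix (ser 2 n κ (step 2 n κ i τ c)) with hP'
  set w : Fin n → κ := Function.update τ i 1 with hwdef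
  set g : Fin n → κ := fun l => degForm 2 (MvPowerSeries.pderiv l (ser 2 n κ c)) w with hg
  have hwi : w i = 1 := by rw [hwdef, Function.update_self]
  have hw0 : w ≠ 0 := fun h => by
    have := congrFun h i
    rw [hwi, Pi.zero_apply] at this
    exact one_ne_zero this
  have hwK : Matrix.vecMul w P = 0 := vecMul_nearPoint_polarMatrix c i τ hM hM'
  -- Euler at the near point: `Σ w_l g_l = a₃(w) = 0`
  have hgw : ∑ l, w l * g l = 0 := by
    rw [← degForm_three_eq_polar_self]
    exact hypersurface_cubic_eq_zero_of_double_successor c i τ hM hM'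
  have he' := hypersurface_milnorEmbDim_step_of_eq_two c i τ hM he hM'
  set K' := LinearMap.ker P'.mulVecLin with hK'
  have hfr' : Module.finrank κ K' = milnorEmbDim 2 n κ (step 2 n κ i τ c) := by
    rw [hK', hP', finrank_ker_polarMatrix hM']
  constructor
  · -- `e' = 2`: a non-zero vector of `ker P'`
    intro he2 v hv
    by_contra hne
    obtain ⟨z, hzK', hz0⟩ : ∃ z ∈ K', z ≠ 0 := by
      by_contra h
      push Not at h
      have hbot : K' = ⊥ := (Submodule.eq_bot_iff _).mpr h
      rw [hbot, finrank_bot] at hfr'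
      omega
    have hzP' : Matrix.vecMul z P' = 0 := (mem_ker_polarMatrix_iff _ _).mp hzK'
    set z0 : Fin n → κ := Function.update z i 0 with hz0def
    -- (E1') off the chart index
    have hE1 : ∀ l, l ≠ i → Matrix.vecMul z0 P l = z i * g l := by
      intro l hl
      have h := congrFun hzP' l
      rw [Pi.zero_apply, hP', vecMul_polarMatrix_ser_step_of_ne c i τ hM z hl] at h
      exact CharTwo.add_eq_zero.mp h
    -- (E2') at the chart index
    have hE2 : ∑ j, z0 j * g j = 0 := by
      have h := congrFun hzP' i
      rw [Pi.zero_apply, hP', vecMul_polarMatrix_ser_step_self c i τ hM z] at h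
      exact h
    -- (E3') via the alternating pairing with `w`
    have hE3 : Matrix.vecMul z0 P i = z i * g i := by
      have hpair : Matrix.vecMul z0 P ⬝ᵥ w = 0 := by
        rw [vecMul_polarMatrix_dotProduct, hwK, dotProduct_zero]
      rw [dotProduct, ← Finset.add_sum_erase _ _ (Finset.mem_univ i), hwi, mul_one] at hpair
      have hrest : ∑ l ∈ Finset.univ.erase i, Matrix.vecMul z0 P l * w l = z i * (∑ l, w l * g l) - z i * g i := by
        rw [← Finset.add_sum_erase _ (fun l => w l * g l) (Finset.mem_univ i), hwi, one_mul, mul_add,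
          add_sub_cancel_left, Finset.mul_sum]
        refine Finset.sum_congr rfl fun l hl => ?_
        rw [hE1 l (Finset.ne_of_mem_erase hl)]
        ring
      rw [hrest, hgw, mul_zero, zero_sub, ← sub_eq_add_neg] at hpair
      exact sub_eq_zero.mp hpair
    -- (E4') all together: `z0 · P = z_i • g`
    have hE4 : Matrix.vecMul z0 P = z i • g := by
      funext l
      rw [Pi.smul_apply, smul_eq_mul]
      by_cases hl : l = i
      · rw [hl]; exact hE3
      · exact hE1 l hl
    by_cases hzi : z i = 0
    · -- `z ∈ ker P`, not a multiple of `w`: the polars at `w` vanish on `ker P = ⟨w, z⟩`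
      have hz0z : z0 = z := by rw [hz0def, ← hzi, Function.update_eq_self]
      rw [hz0z, hzi, zero_smul] at hE4
      rw [hz0z] at hE2
      have hnot : ∀ r : κ, z ≠ r • w := by
        intro r hr
        have h := congrFun hr i
        rw [Pi.smul_apply, smul_eq_mul, hwi, mul_one] at h
        rw [← h, hzi, zero_smul] at hr
        exact hz0 hr
      obtain ⟨a, b, hab⟩ := kernel_span_pair hM he hw0 hwK hE4 hnot v hv
      apply hne
      rw [← hab]
      simp only [Pi.add_apply, Pi.smul_apply, smul_eq_mul, add_mul, Finset.sum_add_distrib, mul_assoc,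
        ← Finset.mul_sum]
      rw [hgw, hE2, mul_zero, mul_zero, add_zero]
    · -- `g` is in the row space of `P`, hence orthogonal to `ker P`
      have hgP : g = Matrix.vecMul ((z i)⁻¹ • z0) P := by
        rw [Matrix.smul_vecMul, hE4, smul_smul, inv_mul_cancel₀ hzi, one_smul]
      apply hne
      have h : ∑ l, v l * g l = Matrix.vecMul ((z i)⁻¹ • z0) P ⬝ᵥ v := by
        rw [← hgP, dotProduct]
        exact Finset.sum_congr rfl fun l _ => mul_comm _ _
      rw [h, vecMul_polarMatrix_dotProduct, hv, dotProduct_zero]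
  · -- the polars at `w` vanish on `ker P`: a kernel vector with `u_i = 0` lies in `ker P'`
    intro hpol
    obtain ⟨v₂, hv₂, hnot, -⟩ := exists_kernel_pair hM he hw0 hwK
    set u : Fin n → κ := v₂ - v₂ i • w with hu
    have hui : u i = 0 := by rw [hu, Pi.sub_apply, Pi.smul_apply, smul_eq_mul, hwi, mul_one, sub_self]
    have huK : Matrix.vecMul u P = 0 := by
      rw [hu, Matrix.sub_vecMul, Matrix.smul_vecMul, hv₂, hwK, smul_zero, sub_zero]
    have hu0 : u ≠ 0 := by
      intro h
      rw [hu, sub_eq_zero] at h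
      exact hnot _ h
    have hu0u : Function.update u i 0 = u := by rw [← hui, Function.update_eq_self]
    have huK' : Matrix.vecMul u P' = 0 := by
      funext l
      rw [Pi.zero_apply]
      by_cases hl : l = i
      · rw [hl, hP', vecMul_polarMatrix_ser_step_self c i τ hM u, hu0u]
        exact hpol u huK
      · rw [hP', vecMul_polarMatrix_ser_step_of_ne c i τ hM u hl, hu0u, huK, Pi.zero_apply, hui, zero_mul,
          add_zero]
    have humem : u ∈ K' := (mem_ker_polarMatrix_iff _ _).mpr huK'
    rcases he' with h0 | h2
    · exfalso
      rw [h0] at hfr'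
      haveI : FiniteDimensional κ K' := FiniteDimensional.finiteDimensional_submodule K'
      have hbot : K' = ⊥ := Submodule.finrank_eq_zero.mp hfr'
      rw [hbot, Submodule.mem_bot] at humem
      exact hu0 humem
    · exact h2

/-- [OURS · L1 W4.6 rung (ii) at `p = 2`, every dimension; NOT a statement of the manuscript] **… AND
CORANK ZERO AT A SIMPLE POINT**: in the same situation, `e(successor) = 0` iff some kernel vector `v` has
`Σ_l v_l g_l ≠ 0` (`w` is a simple point of the kernel cubic). [folklore] -/
theorem hypersurface_milnorEmbDim_step_eq_zero_iff [CharP κ 2] (c : (Fin n → ℕ) → κ) (i : Fin n)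
    (τ : Fin n → κ) (hM : MultP 2 n κ c) (he : milnorEmbDim 2 n κ c = 2)
    (hM' : MultP 2 n κ (step 2 n κ i τ c)) :
    milnorEmbDim 2 n κ (step 2 n κ i τ c) = 0 ↔
      ∃ v : Fin n → κ, Matrix.vecMul v (polarMatrix (ser 2 n κ c)) = 0 ∧
        ∑ l, v l * degForm 2 (MvPowerSeries.pderiv l (ser 2 n κ c)) (Function.update τ i 1) ≠ 0 := by
  have h := hypersurface_milnorEmbDim_step_eq_two_iff c i τ hM he hM'
  have he' := hypersurface_milnorEmbDim_step_of_eq_two c i τ hM he hM'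
  constructor
  · intro h0
    by_contra hne
    push Not at hne
    have := h.mpr hne
    omega
  · rintro ⟨v, hv, hne⟩
    rcases he' with h0 | h2
    · exact h0
    · exact absurd (h.mp h2 v hv) hne

/-- [OURS · L1 W4.6 rung (ii) at `p = 2`, every dimension; NOT a statement of the manuscript] **AT A SIMPLE
POINT OF THE KERNEL CUBIC THE SUCCESSOR IS RESOLVED BY THE NEXT BLOW-UP**: corank-two double state,
double successor at `(i, τ)` whose near vector is a simple point of `a₃|_{ker P}` (some kernel polar at `w`
non-zero) ⇒ the successor is an ISOLATED double point with `μ = 1` (`e = 0`), and NO double point follows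
it (gen 3, `milnorEmbDim_eq_zero_iff`, `hypersurface_not_multP_step_of_milnorEmbDim_eq_zero`). The
FREE near points terminate at once. [folklore] -/
theorem hypersurface_simple_tangent_resolved [CharP κ 2] (c : (Fin n → ℕ) → κ) (i : Fin n)
    (τ : Fin n → κ) (hM : MultP 2 n κ c) (he : milnorEmbDim 2 n κ c = 2)
    (hM' : MultP 2 n κ (step 2 n κ i τ c)) {v : Fin n → κ}
    (hv : Matrix.vecMul v (polarMatrix (ser 2 n κ c)) = 0)
    (hne : ∑ l, v l * degForm 2 (MvPowerSeries.pderiv l (ser 2 n κ c)) (Function.update τ i 1) ≠ 0) :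
    Isol 2 n κ (step 2 n κ i τ c) ∧ mu 2 n κ (step 2 n κ i τ c) = 1 ∧
      ∀ (i' : Fin n) (τ' : Fin n → κ), ¬ MultP 2 n κ (step 2 n κ i' τ' (step 2 n κ i τ c)) := by
  have h0 := (hypersurface_milnorEmbDim_step_eq_zero_iff c i τ hM he hM').mpr ⟨v, hv, hne⟩
  obtain ⟨hI', hμ'⟩ := (milnorEmbDim_eq_zero_iff hM').mp h0
  exact ⟨hI', hμ', fun i' τ' => hypersurface_not_multP_step_of_milnorEmbDim_eq_zero _ hM' h0 i' τ'⟩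

/-- [OURS · L1 W4.6 rung (ii) at `p = 2`, every dimension; NOT a statement of the manuscript] **A SINGULAR
DIRECTION OF THE KERNEL CUBIC IS AN INFINITELY-NEAR DOUBLE POINT WITH CORANK-TWO SUCCESSOR**: for an
isolated corank-two double state and a non-zero kernel vector `λ` at which ALL polars of `a₃` vanish on the
kernel (`Σ_l v_l (∂_l a)₂(λ) = 0` for every kernel `v`), `λ` lies on the cubic (Euler), the successor in
the chart `i` of a non-zero coordinate at `λ / λ_i` is a double point, and its corank is again TWO — the
SATELLITE point continuing the corank-two chain. (With `h₂ ≤ 2` it is isolated with smaller `μ`, gen 4.)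
[folklore] -/
theorem hypersurface_singular_direction_corank_two [CharP κ 2] (c : (Fin n → ℕ) → κ) (hM : MultP 2 n κ c)
    (hI : Isol 2 n κ c) (he : milnorEmbDim 2 n κ c = 2) {lam : Fin n → κ} {i : Fin n} (hli : lam i ≠ 0)
    (hlam : Matrix.vecMul lam (polarMatrix (ser 2 n κ c)) = 0)
    (hsing : ∀ v : Fin n → κ, Matrix.vecMul v (polarMatrix (ser 2 n κ c)) = 0 →
      ∑ l, v l * degForm 2 (MvPowerSeries.pderiv l (ser 2 n κ c)) lam = 0) :
    MultP 2 n κ (step 2 n κ i ((lam i)⁻¹ • lam) c) ∧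
      milnorEmbDim 2 n κ (step 2 n κ i ((lam i)⁻¹ • lam) c) = 2 := by
  have hcub : degForm 3 (ser 2 n κ c) lam = 0 := by
    rw [degForm_three_eq_polar_self]
    exact hsing lam hlam
  have hM' := hypersurface_multP_step_of_vec c hM hI hli hlam hcub
  refine ⟨hM', (hypersurface_milnorEmbDim_step_eq_two_iff c i _ hM he hM').mpr fun v hv => ?_⟩
  rw [update_inv_smul_eq hli]
  -- the polars at `λ/λ_i` are `λ_i⁻²` times those at `λ`
  have hsum : ∑ l, v l * degForm 2 (MvPowerSeries.pderiv l (ser 2 n κ c)) ((lam i)⁻¹ • lam) =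
      (lam i)⁻¹ ^ 2 * ∑ l, v l * degForm 2 (MvPowerSeries.pderiv l (ser 2 n κ c)) lam := by
    rw [Finset.mul_sum]
    refine Finset.sum_congr rfl fun l _ => ?_
    rw [degForm_smul_vec]
    ring
  rw [hsum, hsing v hv, mul_zero]

end CampaignW46.HypersurfacesCharTwo
end Summit.ResolutionOfSingularities.ResolutionOfSingularities.Theorems
end
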